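import Literature.NumberTheory.Sieve.HeathBrownCubicGrossenLFunction
import Literature.NumberTheory.LFunctions.LogDerivPackage
import Literature.NumberTheory.LFunctions.TwistedDedekindRealCharacter
import Literature.NumberTheory.LFunctions.LSeriesContinuationConj
import Literature.NumberTheory.LFunctions.DedekindVonMangoldtPoleBound
import HarnessLib

/-!
# The zero-free-region datum for `L(s, ν^{(j,k)})` and the classical region with conductor

Assembly of the hypotheses `TwistedZFRData` (`TwistedZeroFreeRegion`, Montgomery–Vaughan §11.1
axiomatised) for the `L`-functions `grossenL hq χ j k = L(s, ν^{(j,k)})` of Heath-Brown's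
Grössencharaktere of `ℤ[∛2]` (`HeathBrownCubicGrossenLFunction`), with `η = 1/18`, `A = 1`,
conductor `Q = 16 q³(|j|+|k|+2)²` and constants `C_g, c₁, K₀, C₂` INDEPENDENT of `q, χ, j, k`:

* `Λ₀ = Λ_K` (`vonMangoldtNorm`), `Λ₁ = Λ_ν` (`twistVonMangoldt`), `F = L(s, ν)`;
* **no pole** (`ν²` non-trivial `mod q`): `Λ₂ = Λ_{ν²}` with `ν² = ν^{(2j,k'')}` for `χ²`
  (`exists_sqChar_grossenChar_eq`), its companion bound from the growth package of `L(s, ν²)`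
  (`LogDerivPackage.re_LSeries_le_of_majorant`);
* **pole** (`ν²` trivial, i.e. `ν = χ` real quadratic with `t_χ = 0`, `params_of_isTrivialMod_sq`):
  `Λ₂ = Λ_K` (`three_four_one_real`), companion bound = de la Vallée Poussin for `ζ_K`
  (`exists_re_LSeries_vonMangoldtNorm_le_pole`), reflection from the reality of the coefficients
  (`contF_conj_eq_zero_iff`).

Consequences (`TwistedZFRData.exists_zeroFree_const`, `exists_logDeriv_bound_const`): the classical
zero-free region `σ > 1 − c/(log Q + log(|t|+4))` for `L(s, ν^{(j,k)})` up to at most real zeros in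
the real-character case, and the bound `L'/L ≪ (log Q)³ d⁻¹ log(|t|+4)` in it — the analytic half of
T. Mitsui's prime number theorem with Grössencharakteren (Jap. J. Math. 26 (1956), Lemma 5 = Lemma 9.4
of D. R. Heath-Brown, Acta Math. 186 (2001)); the exceptional real zero is the province of Siegel's
theorem (`SiegelTheoremAbstract`). Everything is PROVED; no new definitions except the abbreviation
`condQZ = 16 condQ`.

## References

* H. L. Montgomery, R. C. Vaughan, *Multiplicative Number Theory I*, CUP 2007, §11.1 Theorem 11.3,
  Lemma 11.1–11.2. [cite: MontgomeryVaughan2007, §11.1 Theorem 11.3]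
* T. Mitsui, *Generalized prime number theorem*, Jap. J. Math. 26 (1956), Lemma 5. [cite: Mitsui1956, Lemma 5]
* D. R. Heath-Brown, *Primes represented by `x³ + 2y³`*, Acta Math. 186 (2001), §9 Lemma 9.4, p. 55.
  [cite: HeathBrownActa2001, §9 Lemma 9.4]

## Mathlib / tree search

Tree: `HeathBrownCubicGrossenLFunction` (everything about `grossenL`, `sqChar`, `condQ`),
`TwistedDedekindCoefficients` (`three_four_one`, majorants, summability, `exists_re_LSeries_vonMangoldtNorm_le`),
`TwistedDedekindRealCharacter.three_four_one_real`, `LogDerivPackage`, `LSeriesContinuationConj`,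
`DedekindVonMangoldtPoleBound`, `TwistedZFRData.exists_zeroFree_const/exists_logDeriv_bound_const`.
-/

noncomputable section

open NumberField Finset Complex Set
open scoped ComplexConjugate

namespace Literature.NumberTheory.Sieve.CubicSieve

open LFunctions LFunctions.NumberField LFunctions.PartialSumContinuation LFunctions.CubeRootTwoField CubicPrimes

variable {q : ℕ}

/-- The conductor of the zero-free-region datum: `Q = 16 q³(|j|+|k|+2)²` (room for the companion
`ν²`, `condQ_sq_le`). [cite: HeathBrownActa2001, §9 Lemma 9.4] -/
def condQZ (q : ℕ) (j k : ℤ) : ℝ := 16 * condQ q j k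

/-- `Q ≥ 1`. [folklore] -/
theorem one_le_condQZ (hq : 1 ≤ q) (j k : ℤ) : 1 ≤ condQZ q j k := by
  have := one_le_condQ hq j k; rw [condQZ]; linarith

/-- `condQ ≤ Q`. [folklore] -/
theorem condQ_le_condQZ (hq : 1 ≤ q) (j k : ℤ) : condQ q j k ≤ condQZ q j k := by
  have := one_le_condQ hq j k; rw [condQZ]; linarith

/-! ### The real-character (pole) case: reality of `ν` and of the coefficients -/

/-- A value `z` of a character with `z² = 1` or `z = 0` is real. [folklore] -/
theorem im_eq_zero_of_sq_eq_one {z : ℂ} (h : z ^ 2 = 1) : z.im = 0 := by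
  have hre := congrArg Complex.re h
  have him := congrArg Complex.im h
  simp [sq, Complex.mul_re, Complex.mul_im] at hre him
  rcases mul_eq_zero.1 (by linarith : z.re * z.im = 0) with h0 | h0
  · rw [h0] at hre; nlinarith
  · exact h0

/-- **In the pole case `ν` is real-valued**: `χ² = χ₀`, `j = k = 0`, `t_χ = 0` give
`ν(I) = χ(β) ∈ {0, ±1}` for a positive generator `β`. [cite: HeathBrownActa2001, §9 p. 55] -/
theorem im_grossenChar_eq_zero (hq : 1 ≤ q) {χ : MulChar (QuotMod q) ℂ} (hχ : χ ^ 2 = 1)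
    (ht : charAngle χ = 0) (I : Ideal (𝓞 K)) : (grossenChar hq χ 0 0 I).im = 0 := by
  by_cases hI : I = ⊥
  · rw [hI, grossenChar_bot]; simp
  have hgen := span_canonGen I
  have hβ := canonGen_ne_zero hI
  have hell : 0 < ellO (canonGen I) := (canonT_pos hI).trans (inWindow_canonGen hI).1
  have hκ : kappaOf χ 0 0 = 0 := by rw [kappaOf, ht]; simp
  rw [← hgen, grossenChar_span hq χ 0 0 hβ, ← nuO, nuO_eq_charW χ 0 0 hell, hκ]
  have h1 : charW 0 0 (embW (realVec (canonGen I))) = 1 := by simp [charW]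
  have h2 : normTwist 0 (embW (realVec (canonGen I))) = 1 := by simp [normTwist]
  rw [h1, h2, mul_one, mul_one]
  by_cases hu : IsUnit (toQuotMod q (canonGen I))
  · obtain ⟨u, hu⟩ := hu
    rw [← hu]
    refine im_eq_zero_of_sq_eq_one ?_
    rw [← MulChar.pow_apply_coe, hχ, MulChar.one_apply_coe]
  · rw [MulChar.map_nonunit χ hu]; simp

/-- In the pole case the norm frequency vanishes: `Θ = 0`. [folklore] -/
theorem thetaOf_eq_zero {χ : MulChar (QuotMod q) ℂ} (ht : charAngle χ = 0) : thetaOf χ 0 0 = 0 := by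
  rw [thetaOf, kappaOf, ht]; simp

/-- In the pole case the twisted coefficients are real. [folklore] -/
theorem conj_twistedCoeff (hq : 1 ≤ q) {χ : MulChar (QuotMod q) ℂ} (hχ : χ ^ 2 = 1) (ht : charAngle χ = 0)
    (n : ℕ) : conj (twistedCoeff hq χ 0 0 n) = twistedCoeff hq χ 0 0 n := by
  rw [twistedCoeff, thetaOf_eq_zero ht, normPhase]
  simp only [zero_mul, Complex.ofReal_zero, Complex.exp_zero, mul_one]
  rw [twistCount, map_sum]
  refine Finset.sum_congr rfl fun I _ ↦ ?_
  exact Complex.conj_eq_iff_im.2 (im_grossenChar_eq_zero hq hχ ht I)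

/-- In the pole case `L(s, ν) = contF b s` (no shift). [folklore] -/
theorem grossenL_eq_contF {χ : MulChar (QuotMod q) ℂ} (hq : 1 ≤ q) (ht : charAngle χ = 0) (s : ℂ) :
    grossenL hq χ 0 0 s = contF (twistedCoeff hq χ 0 0) s := by
  rw [grossenL, thetaOf_eq_zero ht]; simp

/-! ### The datum -/

/-- **The zero-free-region datum for `L(s, ν^{(j,k)})`, uniformly in `q, χ, j, k`**: there are
constants `C_g, c₁ > 0`, `K₀, C₂ ≥ 0` such that for every `q ≥ 1`, every character `χ` of
`(𝓞_K/(q))^×` and all `j, k ∈ ℤ` with `ν^{(j,k)}` non-trivial `mod q`, the hypotheses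
`TwistedZFRData (1/18) 1 C_g c₁ K₀ C₂ pole Q Λ_K Λ_ν Λ₂ L(·, ν)` hold with `Q = condQZ q j k`, some
`Λ₂`, and `pole = true` exactly when `ν²` is trivial `mod q` (the real quadratic characters).
[cite: MontgomeryVaughan2007, §11.1 Theorem 11.3 (hypotheses)] -/
theorem exists_twistedZFRData :
    ∃ Cg c₁ K₀ C₂ : ℝ, 0 < Cg ∧ 0 < c₁ ∧ 0 ≤ K₀ ∧ 0 ≤ C₂ ∧
      ∀ (q : ℕ) (hq : 1 ≤ q) (χ : MulChar (QuotMod q) ℂ) (j k : ℤ),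
        ¬ IsTrivialMod q (grossenChar hq χ j k) →
        ∃ (pole : Bool) (Λ₂ : ℕ → ℂ),
          (pole = true ↔ IsTrivialMod q (sqChar (grossenChar hq χ j k))) ∧
          TwistedZFRData (1 / 18) 1 Cg c₁ K₀ C₂ pole (condQZ q j k)
            (vonMangoldtNorm K) (twistVonMangoldt K (grossenChar hq χ j k)) Λ₂ (grossenL hq χ j k) := by
  classical
  obtain ⟨Cg, hCg, hgrowth⟩ := exists_grossenL_growth
  obtain ⟨c₁, hc₁, hlower⟩ := exists_grossenL_lower
  obtain ⟨K₀, hK₀, hK⟩ := exists_re_LSeries_vonMangoldtNorm_le (K := K)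
  obtain ⟨CK, hCK, hpole⟩ := exists_re_LSeries_vonMangoldtNorm_le_pole K
  -- the package constant `E(1/18, 1, Cg, c₁)` and `C₂`
  set E : ℝ := 8 * (2 * (1 : ℝ) + |Real.log (Cg / (c₁ * ((1 / 18 : ℝ) / 32)))| + 1) / ((1 / 18 : ℝ) / 4)
    with hE
  have hE0 : 0 ≤ E := by rw [hE]; positivity
  set C₂ : ℝ := max (E + 32 / (3 * (1 / 18 : ℝ)) + K₀) CK with hC₂
  have hC₂0 : 0 ≤ C₂ := le_max_of_le_right hCK
  refine ⟨Cg, c₁, K₀, C₂, hCg, hc₁, hK₀, hC₂0, fun q hq χ j k hν ↦ ?_⟩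
  set ν := grossenChar hq χ j k with hνdef
  have hν1 : ∀ I, ‖ν I‖ ≤ 1 := norm_grossenChar_le hq χ j k
  have hQ1 : 1 ≤ condQZ q j k := one_le_condQZ hq j k
  have hQ0 : 0 < condQZ q j k := by linarith
  -- common fields
  have hdiff : DifferentiableOn ℂ (grossenL hq χ j k) {s : ℂ | 1 - 1 / 18 < s.re} :=
    (differentiableOn_grossenL hq χ j k hν).mono fun s hs ↦ by
      simp only [Set.mem_setOf_eq] at hs ⊢; linarith
  have hgr : ∀ s : ℂ, 1 - 1 / 18 < s.re → s.re ≤ 3 →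
      ‖grossenL hq χ j k s‖ ≤ Cg * condQZ q j k ^ (1 : ℝ) * (|s.im| + 4) ^ (1 : ℝ) := by
    intro s hs hs3
    rw [Real.rpow_one, Real.rpow_one]
    refine (hgrowth q hq χ j k hν s hs hs3).trans ?_
    gcongr
    exact condQ_le_condQZ hq j k
  by_cases hsq : IsTrivialMod q (sqChar ν)
  · -- the POLE case: `ν` real quadratic
    obtain ⟨hχ2, hj, hk, ht⟩ := params_of_isTrivialMod_sq hq hsq
    subst hj; subst hk
    refine ⟨true, fun n ↦ (vonMangoldtNorm K n : ℂ), ⟨fun _ ↦ hsq, fun _ ↦ rfl⟩, ?_⟩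
    have hreal : ∀ I, (ν I).im = 0 := im_grossenChar_eq_zero hq hχ2 ht
    exact {
      eta_pos := by norm_num
      eta_le_one := by norm_num
      A_nonneg := zero_le_one
      Cg_pos := hCg
      c₁_pos := hc₁
      K₀_nonneg := hK₀
      C₂_nonneg := hC₂0
      one_le_Q := hQ1
      nonneg := vonMangoldtNorm_nonneg
      summable := fun s hs ↦ LSeriesSummable_vonMangoldtNorm (K := K) hs
      re_LSeries₀_le := hK
      norm_le₁ := norm_twistVonMangoldt_le hν1
      norm_le₂ := fun n ↦ by
        rw [Complex.norm_real, Real.norm_of_nonneg (vonMangoldtNorm_nonneg n)]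
      three_four_one := fun σ hσ t ↦ three_four_one_real hν1 hreal hσ t
      differentiableOn := hdiff
      ne_zero := fun s hs ↦ grossenL_ne_zero hq χ 0 0 hν hs
      logDeriv_eq := fun s hs ↦ logDeriv_grossenL hq χ 0 0 hν hs
      growth := hgr
      lower := fun s hs hs2 ↦ hlower q hq χ 0 0 hν s hs hs2
      re_LSeries₂_le := fun s hs hs2 ↦ by
        simp only [ite_true]
        refine (hpole s hs).2.trans ?_
        have hlogQ : 0 ≤ Real.log (condQZ q 0 0) := Real.log_nonneg hQ1
        have hlt : 0 ≤ Real.log (|s.im| + 4) := (ClassicalZFRData.log_tau_pos _).le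
        have : CK * Real.log (|s.im| + 4) ≤ C₂ * (Real.log (condQZ q 0 0) + Real.log (|s.im| + 4)) := by
          have hCKle : CK ≤ C₂ := le_max_right _ _
          nlinarith
        linarith
      reflect := fun _ ρ _ hρ ↦ by
        rw [grossenL_eq_contF hq ht] at hρ ⊢
        exact (contF_conj_eq_zero_iff (conj_twistedCoeff hq hχ2 ht) ρ).2 hρ }
  · -- the NO-POLE case: the companion `ν² = ν^{(2j,k'')}` is non-trivial
    obtain ⟨k'', hk'', -, hsqeq⟩ := exists_sqChar_grossenChar_eq hq χ j k
    have hν'' : ¬ IsTrivialMod q (grossenChar hq (χ ^ 2) (2 * j) k'') := by rwa [← hsqeq]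
    set ν'' := grossenChar hq (χ ^ 2) (2 * j) k'' with hν''def
    have hν''1 : ∀ I, ‖ν'' I‖ ≤ 1 := norm_grossenChar_le hq (χ ^ 2) (2 * j) k''
    refine ⟨false, twistVonMangoldt K ν'', ⟨fun h ↦ absurd h Bool.false_ne_true, fun h ↦ absurd h hsq⟩, ?_⟩
    -- the growth package of `L(s, ν'')` with the SAME conductor `Q`
    have hpack : LogDerivPackage (1 / 18) 1 Cg c₁ (condQZ q j k) (twistVonMangoldt K ν'')
        (grossenL hq (χ ^ 2) (2 * j) k'') :=
      { eta_pos := by norm_num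
        eta_le_one := by norm_num
        A_nonneg := zero_le_one
        Cg_pos := hCg
        c₁_pos := hc₁
        one_le_Q := hQ1
        differentiableOn := (differentiableOn_grossenL hq (χ ^ 2) (2 * j) k'' hν'').mono fun s hs ↦ by
          simp only [Set.mem_setOf_eq] at hs ⊢; linarith
        ne_zero := fun s hs ↦ grossenL_ne_zero hq (χ ^ 2) (2 * j) k'' hν'' hs
        logDeriv_eq := fun s hs ↦ logDeriv_grossenL hq (χ ^ 2) (2 * j) k'' hν'' hs
        growth := fun s hs hs3 ↦ by
          rw [Real.rpow_one, Real.rpow_one]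
          refine (hgrowth q hq (χ ^ 2) (2 * j) k'' hν'' s hs hs3).trans ?_
          have h16 := condQ_sq_le (q := q) j k k'' hk''
          rw [condQZ]
          gcongr
        lower := fun s hs hs2 ↦ hlower q hq (χ ^ 2) (2 * j) k'' hν'' s hs hs2 }
    have hmaj := hpack.re_LSeries_le_of_majorant hK₀ (norm_twistVonMangoldt_le hν''1)
      (fun s hs ↦ LSeriesSummable_vonMangoldtNorm (K := K) hs) hK
    exact {
      eta_pos := by norm_num
      eta_le_one := by norm_num
      A_nonneg := zero_le_one
      Cg_pos := hCg
      c₁_pos := hc₁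
      K₀_nonneg := hK₀
      C₂_nonneg := hC₂0
      one_le_Q := hQ1
      nonneg := vonMangoldtNorm_nonneg
      summable := fun s hs ↦ LSeriesSummable_vonMangoldtNorm (K := K) hs
      re_LSeries₀_le := hK
      norm_le₁ := norm_twistVonMangoldt_le hν1
      norm_le₂ := norm_twistVonMangoldt_le hν''1
      three_four_one := fun σ hσ t ↦ by
        have h := three_four_one hν1 (ν₂ := sqChar ν) (fun I ↦ rfl) hσ t
        rwa [hsqeq] at h
      differentiableOn := hdiff
      ne_zero := fun s hs ↦ grossenL_ne_zero hq χ j k hν hs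
      logDeriv_eq := fun s hs ↦ logDeriv_grossenL hq χ j k hν hs
      growth := hgr
      lower := fun s hs hs2 ↦ hlower q hq χ j k hν s hs hs2
      re_LSeries₂_le := fun s hs hs2 ↦ by
        simp only [Bool.false_eq_true, ite_false, zero_add]
        refine (hmaj s hs hs2).trans ?_
        have hℒ : 0 ≤ Real.log (condQZ q j k) + Real.log (|s.im| + 4) :=
          (TwistedZFR.ell_pos hQ1 s.im).le
        refine mul_le_mul_of_nonneg_right ?_ hℒ
        rw [hC₂, hE]; exact le_max_left _ _
      reflect := fun h ↦ absurd h Bool.false_ne_true }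

/-! ### Consequences: the classical region and the logarithmic derivative -/

/-- **The classical zero-free region for `L(s, ν^{(j,k)})` with conductor**, up to real zeros of the
real quadratic characters: there is an absolute `c > 0` such that for all `q ≥ 1`, `χ`, `j`, `k`
with `ν^{(j,k)}` non-trivial `mod q`, every zero `ρ` of `L(s, ν)` (`σ > 8/9`) with
`Re ρ > 1 − c/(log Q + log(|Im ρ| + 4))`, `Q = 16q³(|j|+|k|+2)²`, is REAL and `ν²` is trivial
(`ν` real quadratic) — the candidate Siegel zero. [cite: MontgomeryVaughan2007, §11.1 Theorem 11.3] -/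
theorem exists_zeroFree_grossenL :
    ∃ c : ℝ, 0 < c ∧ ∀ (q : ℕ) (hq : 1 ≤ q) (χ : MulChar (QuotMod q) ℂ) (j k : ℤ),
      ¬ IsTrivialMod q (grossenChar hq χ j k) → ∀ ρ : ℂ, grossenL hq χ j k ρ = 0 →
        1 - c / (Real.log (condQZ q j k) + Real.log (|ρ.im| + 4)) < ρ.re →
          IsTrivialMod q (sqChar (grossenChar hq χ j k)) ∧ ρ.im = 0 := by
  obtain ⟨Cg, c₁, K₀, C₂, hCg, hc₁, hK₀, hC₂, hdata⟩ := exists_twistedZFRData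
  obtain ⟨c, hc, hzf⟩ := TwistedZFRData.exists_zeroFree_const (η := 1 / 18) (A := 1) (Cg := Cg)
    (c₁ := c₁) (K₀ := K₀) (C₂ := C₂) (by norm_num) zero_le_one hK₀ hC₂
  refine ⟨c, hc, fun q hq χ j k hν ρ hρ hre ↦ ?_⟩
  obtain ⟨pole, Λ₂, hpole, h⟩ := hdata q hq χ j k hν
  obtain ⟨hp, him⟩ := hzf pole _ _ _ _ _ h ρ hρ hre
  exact ⟨hpole.1 hp, him⟩

end Literature.NumberTheory.Sieve.CubicSieve
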